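import Mathlib
import HarnessLib
import HarnessLib.Audit
import Summits.MatrixMultiplication.Statement
import Literature.Computability.AlgebraicComplexity.MatrixMultiplicationExponent
import Literature.Computability.AlgebraicComplexity.AsymptoticSpectrum
import Literature.Computability.AlgebraicComplexity.SchoenhageTau
import Literature.Computability.AlgebraicComplexity.BorderRankCW
import Literature.Computability.AlgebraicComplexity.XyzCubeFlattening
import Literature.Computability.AlgebraicComplexity.CoppersmithWinograd1990Proofs
import Literature.Computability.AlgebraicComplexity.BorderRankKronecker
import HarnessLib.Audit.Status.Attr

/-!
Route: HesseHammingShells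

DORMANT since 2026-08-25T02:53:10Z (reconciler: no traction for 7.3 d (last activity item-evidence-added at 2026-08-17T18:57:05Z); parked, not closed — `ledger route dormant route-MatrixMultiplication-HesseHammingShells --off` to reacti) — unstaffed, not closed; items shared with open routes are served there. `ledger route dormant <id> --off` reactivates.

# Route HesseHammingShells — omega = 2 from border-rank uniformity over the Hamming shells of the
Z_3^N addition table (Hesse pencil)

It suffices to show X = SHELL UNIFORMITY (card hesse-pencil-hamming-shells, item H1): for every ε >
0 there is C such that
bR(H_m^(N)) ≤ C·3^((1+ε)N) for all N and all m ≤ N, where H_m^(N)(x,y,z) := [x+y+z = 0 in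
Z_3^N]·[d_H(x,y) = m] is the radius-m
Hamming shell of the Z_3^N addition table (an explicit 0/1 tensor on (Fin N → Fin 3)^3; bR =
algBorderRank). The top shell IS the
N-th Kronecker power of the permutation tensor xyz = Σ_{σ∈S_3} e_σ0⊗e_σ1⊗e_σ2 ≅ T_cw,2 (H_N^(N) =
xyz^{⊠N} entrywise), so X gives
R~(T_cw,2) = 3 and ω = 2 (CoppersmithWinograd1990 §11, proved in tree as
CoppersmithWinograd1990_asymptoticRank_form_holds). The shells
are the coefficients of the Hesse pencil: (Δ + s·xyz)^{⊠N} = Σ_m s^m H_m^(N), Δ + s·xyz = T_(1,s,s)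
= the polarisation of
x³+y³+z³+6s·xyz; hence X says "Hesse-form plane cubics are asymptotically as cheap as the Fermat
cubic, uniformly in s", and X
factors as (xyz is the generic point of the Hesse line) ∧ (X_B of route AsymptoticRankCW).
Lean: `∀ ε : ℝ, 0 < ε → ∃ C : ℝ, ∀ N m : ℕ, m ≤ N →
(Literature.Computability.AlgebraicComplexity.algBorderRank (fun x y z : Fin N → Fin 3 => if (∀ i, x
i + y i + z i = 0) ∧ (Finset.univ.filter (fun i => x i ≠ y i)).card = m then (1 : ℂ) else 0) : ℝ) ≤
C * (3 : ℝ) ^ ((1 + ε) * N)`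

## Assembly
Pure bookkeeping over PROVED tree facts: given X, take m = N; TopShellIsXyzPower rewrites H_N^(N) as
kroneckerPow (xyzTensor ℂ) N; for
each ε pick N₀ with C·3^((1+ε)N₀) ≤ 3^((1+2ε)N₀) =: r-scale and de-border the fixed tensor xyz^{⊠N₀}
(isBigO_tensorRank_kroneckerPow_of_algBorderRank_le, BorderRankKronecker.lean; powers of powers
reindex by tensorRank_reindex, padding by
submultiplicativity) to get R(xyz^{⊠n}) = O(3^((1+3ε)n)); XyzRestrictsToCw with
TensorRestrictsTo.kroneckerPow / tensorRank_le gives the same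
for T_cw,2^{⊠n}, i.e. X_B; then matrixMultiplication_of_cw_two
CoppersmithWinograd1990_asymptoticRank_form_holds (omega_two_le ℂ), exactly
the candidate proof already attached to stmt-MatrixMultiplication-0589. No unproved named fact is
used.

Rationale: WHY THIS LINE. Mechanism: re-coordinatise the Kronecker powers of the small Coppersmith–Winograd
tensor as the antipodal Hamming shell of the Z_3^N
convolution and attack ALL shells at once, so that the generating identity (Δ + s·xyz)^{⊠N} = Σ_m
s^m H_m^(N) ties them to ONE
algebraic curve of 3×3×3 tensors — the Hesse line s ↦ T_(1,s,s) inside Nurmiev's Cartan plane a·Δ +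
b·Cyc + c·Cyc' of semisimple
tensors (Vinberg1976, Nurmiev2000, BremnerHuOeding2014) — on which asymptotic rank is constant off
finitely many cheaper points
(arXiv:2411.15789 Thm 1.2) and equals 3 = rank at exactly four unit points s ∈ {0, 1, ω, ω²}
(T_(1,ω,ω) = ω^{2(x²+y²+z²)}·[x+y+z=0]).
Imported: association schemes / harmonic analysis on H(N,3) (Delsarte1973: shells = adjacency
relations, Fourier self-duality
H_m ↦ Σ_k K_m(k) H_k with Kravchuk coefficients, checked at N = 2: H_1^(2) ≅ 4H_0 + H_1 − 2H_2),
3×3×3 invariant theory (the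
Cartan plane and its Weyl group of order 648), and Zariski semicontinuity (arXiv:2411.15789;
BurgisserClausenShokrollahi1997 Thm 20.3).
Free structure already visible: shells grouped by radius mod 3 have RANK ≤ 3^(N+1) (interpolation
through the unit points; the
shell degree is a torus weight mod 3 via quadratic phases but not over ℤ — summing the six
permutation cells against the three
diagonal cells gives 6 = 0, the exact obstruction to laser-type extraction), and no shell is a TORIC
degeneration of a class containing
another shell (all shell supports have uniform marginals), so any extraction must be genuinely
algebraic. What route AsymptoticRankCW
does not have: an N-indexed symmetric family with an inductive/generating structure around its
target, the factorisation
Hesse-ARC = TriangleIsGeneric ∧ X_B, and a 1-parameter moduli on which refuters can hunt a dark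
spectral point on a SMOOTH cubic.
Relation to route HessianPlane (opened 2026-08-15T11:35Z for the sibling card
hessian-plane-weighted-z3-tables): its target
HessianPlaneFlat (stmt-MatrixMultiplication-4891, R~ ≤ 3 pointwise on the whole Cartan plane)
contains HesseLineARC as the case
b = c — the Hesse line is one of its nine border-rank-4 lines W·{b = c} — and its cruxes are
degree-2 (Kronecker-square) statements;
this route lives on that one curve because only there the type decomposition of u(a,b,c)^{⊠N}
collapses to Hamming shells with a
one-variable generating function, works at all degrees N at once (uniformity in s, not pointwise
flatness), and contributes the
crux TriangleIsGeneric and the radius-mod-3 theorem, which have no counterpart there;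
BThesis/Assembly of AsymptoticRankCW are shared
by all three routes by signature.

RANKED CRUXES. #0 ShellUniformity (target) — X as in § Thesis: border-rank uniformity 3^((1+ε)N)
over all Hamming shells H_m^(N), m ≤ N, of the Z_3^N addition table. (why it might fail: middle
shells m ≈ 2N/3 are sums of C(N,m) ≈ 3^N/2^m translates of xyz^{⊠m}⊠Δ^{⊠(N−m)} and no absorption
beyond radius mod 3 is known; X = ARC for the generic Hesse cubic, strictly stronger than R~(cw_2) =
3.) [ConnerGesmundoLandsbergVentura2022, arXiv:2411.15789, Landsberg2017, Delsarte1973]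
#2 HesseLineARC (crux) — every member of the Hesse line has asymptotic rank ≤ 3: ∀ s ∈ ℂ,
R~(T_(1,s,s)) ≤ 3, T_(1,s,s)(x,y,z) = [x+y+z=0]·(1 if x=y else s) (Strassen's concise
asymptotic-rank conjecture, Landsberg2017 Conj 3.4.6.4, restricted to the pencil x³+y³+z³+6s·xyz;
known at the four unit points s ∈ {0,1,ω,ω²}, open at every other s including the four triangle
points s ∈ {−1/2, −ω/2, −ω²/2, ∞} ≅ cw_2; card items H1/negative twin). Necessary for X (support
TargetImpliesHesseARC); at s = −1/2 it is X_B. [difficulty: open-problem] (why it might fail: one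
universal spectral point > 3 at one smooth cubic refutes it and ARC in format (3,3,3); all quantum
functionals equal 3 on the line (semistable points), so it needs a NEW spectral point; and it
contains X_B (s = −1/2), open since 1990.) [Landsberg2017, Strassen1991, ChristandlVranaZuiddam2023,
arXiv:2411.15789, AlmanLi2026, BurgisserClausenShokrollahi1997]
#3 TriangleIsGeneric (crux) — the triangle xyz (≅ cw_2) is a generic point of the Hesse line for
asymptotic rank: ∀ s, R~(T_(1,s,s)) ≤ R~(xyz). By arXiv:2411.15789 Thm 1.2, R~ takes a generic value
θ_H on the line and is smaller only at finitely many s; the crux says cw_2 is not exceptional, i.e.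
θ_H = R~(cw_2); equivalently (interpolation over N+1 generic parameters + Zariski semicontinuity of
bR) the border shell rate lim_N max_m bR(H_m^(N))^{1/N} equals R~(cw_2): "no middle-shell bulge".
Necessary for X, and X ⟺ TriangleIsGeneric ∧ X_B modulo that semicontinuity glue (card item H2
recast; new statement). [difficulty: XL] (why it might fail: xyz has a 2-dimensional torus
stabiliser, smooth Hesse members only a finite one (order 648·scalars); if symmetry buys asymptotic
savings (as in AlmanLi2026's cw_2-specific speed-ups) the generic member is strictly dearer, θ_H >
R~(cw_2), and middle shells bulge.) [arXiv:2411.15789, AlmanLi2026,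
ConnerGesmundoLandsbergVentura2022, Nurmiev2000, BremnerHuOeding2014]
#4 CwTwoAsymptoticRankThree (crux) — X_B of route AsymptoticRankCW verbatim (shared item
stmt-MatrixMultiplication-0588): R~(T_cw,2) = 3 in growth form, R(T_cw,2^{⊠N}) = O(3^((1+ε)N)) for
every ε > 0; here it is the TOP-SHELL case m = N of X (H_N^(N) = xyz^{⊠N} ≅ T_cw,2^{⊠N}) and the
second factor of HesseLineARC. [difficulty: open-problem] (why it might fail: open since
CoppersmithWinograd1990 (Blaser2013 Problem 9.8); known 3 ≤ R~(T_cw,2) < 3.931 (AlmanLi2026 Thm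
1.3), Kronecker square bR-multiplicative (= 16, ConnerHuangLandsberg2020 Thm 1.1); ω > 2 or a
spectral point > 3 at T_cw,2 kills it.) [Blaser2013, AlmanLi2026, ConnerHuangLandsberg2020,
ConnerGesmundoLandsbergVentura2022, BurgisserClausenShokrollahi1997]
#9 TopShellIsXyzPower (support) — the top shell is the N-th Kronecker power of the tree's xyz tensor
on the nose: [∀i, x_i+y_i+z_i=0] ∧ #{i : x_i ≠ y_i} = N iff (x_i,y_i,z_i) is a permutation of
(0,1,2) for every i (per-coordinate decidable fact, then Finset.prod). [difficulty: provable-now]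
[ConnerGesmundoLandsbergVentura2022]
#9 XyzRestrictsToCw (support) — xyz ≥ T_cw,2 over ℂ (the inverse of the tree's
tensorRestrictsTo_cwTensor_xyzTensor: cwToXyz is invertible, rows (1,0,0),(0,1,i),(0,1/2,−i/2));
with TensorRestrictsTo.kroneckerPow and tensorRank_le it turns top-shell bounds into bounds for
R(T_cw,2^{⊠N}). [difficulty: provable-now] [ConnerGesmundoLandsbergVentura2022]
#9 HessePowerExpansion (support) — generating identity: the N-th Kronecker power of the Hesse member
T_(1,s,s) expands over the shells, T_(1,s,s)^{⊠N}(x,y,z) = Σ_{m ≤ N} s^m H_m^(N)(x,y,z) (entrywise: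
∏_i [x_i+y_i+z_i=0]·s^{[x_i≠y_i]} = [x+y+z=0]·s^{d_H(x,y)}). [difficulty: provable-now]
[Delsarte1973, ConnerGesmundoLandsbergVentura2022]
#9 ClassRankBound (support) — FREE THEOREM (new): the shells grouped by radius mod 3, G_r^(N) :=
Σ_{m ≡ r (3)} H_m^(N), have RANK ≤ 3^(N+1): G_r = (1/3)Σ_{j=0,1,2} ω^{−rj} T_(1,ω^j,ω^j)^{⊠N} by
HessePowerExpansion, and each T_(1,ω^j,ω^j)^{⊠N} has rank 3^N (UnitPointPowers); then
tensorRank_sum_le. Documents that resolving the radius beyond mod 3 is the whole difficulty.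
[difficulty: M] [Delsarte1973, BurgisserClausenShokrollahi1997]
#9 UnitPointPowers (support) — at the four unit points s ∈ {0} ∪ μ_3 the Hesse member is a unit
tensor in disguise and its powers have rank ≤ 3^N: T_(1,0,0) = ⟨3⟩; T_(1,1,1) = the Z_3 addition
table ≅ ℂ[Z_3] ≅ ⟨3⟩; T_(1,ω,ω) = ω^{2x²+2y²+2z²}·T_(1,1,1) and T_(1,ω²,ω²) = ω^{x²+y²+z²}·T_(1,1,1)
(diagonal rescalings; identities checked numerically 2026-08-15); Kronecker powers of restrictions
of ⟨3⟩ restrict from ⟨3^N⟩ (TensorRestrictsTo.kroneckerPow, GroupAlgebraTensor lemmas). [difficulty: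
M] [BurgisserClausenShokrollahi1997, Nurmiev2000]
#9 TargetImpliesHesseARC (support) — glue X → HesseLineARC: by HessePowerExpansion and subadditivity
of algBorderRank under sums and scalars, bR(T_(1,s,s)^{⊠N}) ≤ (N+1)·max_m bR(H_m^(N)) ≤
(N+1)·C·3^((1+ε)N); then R~(t)^N = R~(t^{⊠N}) ≤ bR(t^{⊠N}) (asymptoticRank_le_algBorderRank,
advxxz2025_asymptoticRank_tendsto, tensorRank_reindex) and ε → 0. [difficulty: M]
[BurgisserClausenShokrollahi1997, ChristandlVranaZuiddam2023]
#9 HesseFactorisation (support) — glue HesseLineARC ↔ (TriangleIsGeneric ∧ X_B): (→) 3 ≤ R~(xyz)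
from the flattening/gauge-point lower bound (xyz concise), and at s = −1/2 the member is the
triangle: x³+y³+z³−3xyz = (x+y+z)(x+ωy+ω²z)(x+ω²y+ωz), so T_(1,−1/2,−1/2) = gᵀ·(xyz/6) with g the
3×3 matrix of these lines (checked numerically), hence R~(T_(1,−1/2,−1/2)) = R~(xyz) = R~(T_cw,2)
(XyzRestrictsToCw + tree's converse) and inf ≤ 3 gives the growth form (Fekete bookkeeping as in
CoppersmithWinograd1990Proofs); (←) chain the two inequalities after converting X_B's growth form to
R~(xyz) ≤ 3. [difficulty: M] [ConnerGesmundoLandsbergVentura2022, BurgisserClausenShokrollahi1997,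
AlmanLi2026]

TWO-LAYER PLAN. Foreseen glued splits (nothing filed now): HesseLineARC ⇐ TriangleIsGeneric →
CwTwoAsymptoticRankThree → HesseLineARC (glue =
HesseFactorisation, k = 2); ShellUniformity ⇐ HesseLineARC → HesseSemicontinuity → ShellUniformity,
where HesseSemicontinuity :=
"for each N, r the set {s : bR(T_(1,s,s)^{⊠N}) ≤ r} is finite or all of ℂ" (Alder's theorem,
BurgisserClausenShokrollahi1997 Thm 20.3,
not yet vendored) plus Vandermonde interpolation of the shells through N+1 generic parameters;
TriangleIsGeneric ⇐ (asymptotic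
degeneration xyz^{⊠(N+o(N))} ⊵ T_(1,s,s)^{⊠N} for smooth members) → TriangleIsGeneric (k = 1 +
glue), the constructive form a prover
would actually build W-equivariantly on the Cartan plane.

KILL CRITERIA. A universal spectral point F with F(T_(1,s,s)) > 3 for some s (necessarily a NEW,
non-quantum point: a "dark point on a smooth cubic")
refutes HesseLineARC and the target — close `refuted:HesseLineARC` unless it sits only at
non-triangle s, in which case pivot to the
top shell alone (= route AsymptoticRankCW) and record θ_H > 3 as the first counterexample to the
concise ARC in format (3,3,3).
F(cw_2) > 3, ω > 2 (route BorderRankLowerBound) or lim inf bR(T_cw,2^{⊠k})^{1/k} = 4 refute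
CwTwoAsymptoticRankThree and close this
route together with AsymptoticRankCW. TriangleIsGeneric refuted (θ_H > R~(cw_2)) demotes the target
to false-but-informative: close
`refuted:TriangleIsGeneric` (the shell engine is lossy) — X_B itself survives in route
AsymptoticRankCW. X_B proved elsewhere moots
the assembly but not cruxes 2–3 (they become the format-(3,3,3) ARC programme).

NOT DECOMPOSED YET. The extraction step "single shell from its radius-mod-3 class at cost 3^{o(N)}"
(card item H2) is NOT filed: toric extraction is
provably impossible (uniform marginals) and no algebraic candidate is typed yet; the semicontinuity
glue (Alder / CHNVZ facts) waits
for the two cite facts below; the Cartan-plane symmetry (W of order 648, Fourier self-duality with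
Kravchuk coefficients, the
quadratic-phase gauge group of weighted Z_3^N tables) is recorded as tools, not items; finite
calibrations (bR of H_1^(2) ∈ [9,24],
of H_1^(3), H_2^(3) ≤ 81 by ClassRankBound versus bR(H_3^(3)) = bR(cw_2^{⊠3}) ∈ [45,64]) are refuter
kit jobs, not items, because
Koszul flattenings cannot certify the informative direction (LinearRankMethodBarrier: ≤ 16.2 on ℂ⁹,
≤ ~50 on ℂ²⁷). Stratum (ii) of
the card (twisted group algebras, TAC for the Weyl cocycle on Z_n² = ω = 2 verbatim) is deliberately
not an item.

CHEAPEST FALSIFIER. (1) Numerics a refuter can run in minutes: numerical border-rank fits of the two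
middle shells of Z_3^3 (27×27×27, 0/1, S_3×Z_3^3-symmetric):
a stable fit needing > 64 terms for H_2^(3) while H_3^(3) = cw_2^{⊠3} fits in ≤ 64 is evidence for a
middle bulge (against
TriangleIsGeneric and the target; not a proof). (2) Lookup: does arXiv:2411.15789 §5 or
Kaski–Michałek arXiv:2404.06427 already
state that R~ is constant on the Hesse pencil off j = 0, or exhibit an exceptional smooth cubic?
(read 2026-08-15: 2411.15789 p.14
names only the hyperdeterminant-0 family and the 6-cell support family; no pencil statement). (3)
Semicontinuity sanity check, done
by hand 2026-08-15: bR(cw_2^{⊠2}) = 16 forces bR(T_(1,s,s)^{⊠2}) = 16 for generic s, so NO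
finite-power certificate at a generic member
can beat the same certificate at cw_2 — the pencil pays only through all-powers structure; a refuter
finding bR(T_(1,s,s)^{⊠2}) ≤ 15
numerically for some s would contradict ConnerHuangLandsberg2020 and signal a bug, not a result.

NUMBERS. 3 ≤ R~(T_cw,2) < 3.931 (AlmanLi2026 Thm 1.3); bR(T_cw,2) = 4, R = 4 (Waring rank of xyz);
bR(T_cw,2^{⊠2}) = 16 (ConnerHuangLandsberg2020
Thm 1.1); 45 ≤ bR(T_cw,2^{⊠3}) ≤ 64 (ConnerGesmundoLandsbergVentura2022 Thm 1.2, q = 2 cube clause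
proved in tree); 15·3^(N−2) ≤
bR(cw_2^{⊠N}) ≤ 4^N. On the Hesse line: rank 3 exactly at s ∈ {0,1,ω,ω²}; bR = 4 elsewhere (ternary
cubics have generic symmetric
rank 4); triangle members s ∈ {−1/2, −ω/2, −ω²/2} and s = ∞. Free bounds: R(G_r^(N)) ≤ 3^(N+1) (so
R(H_1^(3)), R(H_2^(3)) ≤ 81 < 108,
144 naive); R(H_1^(2)) ≤ 24, bR(H_0^(N)) = 3^N. Every quantum functional equals 3 on every concise
member of the Cartan plane. Items at
open: 12 (1 target, 3 cruxes, 7 support, 1 assembly).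

DEFINITION REQUESTS. None (shells, Hesse members and the class tensors are inline 0/1/s tensors over
tree definitions kroneckerPow, algBorderRank,
asymptoticRank, xyzTensor, cwTensor). Facts wanted as cite items (hypotheses for the layer-2
semicontinuity glue): (F1) arXiv:2411.15789
Thm 1.2 — for every r the set {T : R~(T) ≤ r} is Zariski closed
(Christandl–Hoeberechts–Nieuwboer–Vrana–Zuiddam 2024/25); (F2) Alder's
theorem, BurgisserClausenShokrollahi1997 Thm (20.3) — {t : bR(t) ≤ r} is the (Zariski closed,
irreducible) secant variety, in the
tree's algBorderRank language.

Novelty: Searches (2026-08-15): `lit search --source zbmath "Kronecker powers tensors Strassen laser method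
border rank"` (1: arXiv:1909.04785);
`lit search --source zbmath "Hesse pencil tensor rank"` (1, irrelevant), `"weighted group table
tensor asymptotic rank abelian"` (0),
`"asymptotic rank cubic form Hesse normal form tensor rank"` (0); `lit search --hybrid --source
local "asymptotic rank generic 3x3x3 tensor
cw_2 hyperdeterminant closedness"` (Landsberg2017 pp.72,148: Conj 3.4.6.4, Rem 5.6.4.3;
BurgisserClausenShokrollahi1997 Rem 15.44, Thm 20.3);
`lit read arXiv:2411.15789 --grep …` (p.14 §5 read); arXiv / OpenAlex / Semantic Scholar APIs
rate-limited (HTTP 429) and `lit galaxy search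
… --star all` queue-saturated (> 90 s) during the session — recorded, not retried endlessly; the
card's own audit (refuter 7-0) had run
zbMATH "Hamming scheme tensor rank", "twisted group algebra matrix multiplication exponent", "normal
forms 3x3x3 tensors" (0 relevant) and
grepped CGLV / CHNVZ for Hamming|shell|Kravchuk (0).
Nearest prior art found: arXiv:2411.15789 §5 last bullet (cw_2 ≤ generic R~ of hyperdeterminant-0
tensors and of the generic tensor on
the 6-cell support Δ ∪ Cyc — closedness × a weighted-Z_3-table family, for two OTHER families) and
ConnerGesmundoLandsbergVentura2022
(Kronecker powers of cw_2, xyz model, Koszul bounds); Cartan plane: Nurmiev2000,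
BremnerHuOeding2014; internal: route HessianPlane
(2026-08-15, pointwise flatness on the plane, degree-2 cruxes) whose target spe  [refs: 1909.04785, 2411.15789, Landsberg2017, BurgisserClausenShokrollahi1997, ConnerGesmundoLandsbergVentura2022, Nurmiev2000, BremnerHuOeding2014]

Barriers (technique_class: weighted-group-table, hamming-scheme, small-cw): - technique_class: weighted-group-table, hamming-scheme, small-cw
- Literature.Barriers.MatrixMultiplication.IrreversibilityBarrier: applies only to the assembly's
last step (fixed intermediate tensor cw_2, CVZ Thm 19) and is numerically void there (bound = 2
exactly at q = 2, CVZ Rem 20); it bites iff R~(cw_2) > 3, i.e. iff crux 4 is false — barrier and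
kill criterion coincide; no other intermediate tensor is degenerated to matrix products.
- Literature.Barriers.MatrixMultiplication.UniversalMethodBarrier: same verdict (Alman2021 §4.2: ω_u
bound = 2 at cw_2, tensors with S~ = R~ unobstructed); smooth Hesse members are never used as
intermediates.
- Literature.Barriers.MatrixMultiplication.UnstableTensorBarrier: does not apply — every point of
the Cartan plane is semisimple (closed SL_3³-orbit) and off the unit locus not of minimal border
rank; the shells H_m^(N) have uniform marginals (critical points).
- Literature.Barriers.MatrixMultiplication.LinearRankMethodBarrier: constrains only refutations of
finite shell bounds (Koszul flattenings certify ≤ 16.2 on ℂ⁹, ≤ ~50 on ℂ²⁷), which is why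
calibrations are kit jobs and not items; the positive line uses no rank method.
- Literature.Barriers.MatrixMultiplication.InfimumNotMinimumBarrier: respected — every statement is
a rate over N or an asymptotic rank; no single algorithm is asserted.
- Literature.Barriers.MatrixMultiplication.RectangularBarrier: n/a (square ω only, no T-method to
rectangular shapes); group-theoretic entries

History (route lifecycle, newest last):
- 2026-08-16T04:10:51Z · AUTO-CRUX (backfill): ShellUniformity — hypotheses of the deciding theorem that nothing in the route derives are cruxes (operator:999:1085951)
- 2026-08-25T02:53:10Z · DORMANT — reconciler: no traction for 7.3 d (last activity item-evidence-added at 2026-08-17T18:57:05Z); parked, not closed — `ledger route dormant route-MatrixMultiplica (operator:999:268100)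

sub-problem: MatrixMultiplication · status: dormant · opened planner-plancard-MatrixMultiplication-MatrixM-1777fd95-0 2026-08-15T11:40:13Z · rev 2 · ledger route-MatrixMultiplication-HesseHammingShells
GENERATED by the gate from the ledger (D-0016/17). Provers cite these decls: `theorem foo : Summit.MatrixMultiplication.MatrixMultiplication.Theses.HesseHammingShells.<Decl> := …` in Summits/MatrixMultiplication/MatrixMultiplication/Theorems/<Name>.lean.
-/

namespace Summit.MatrixMultiplication.MatrixMultiplication.Theses.HesseHammingShells

open scoped BigOperators Topology Manifold Classical MeasureTheory ProbabilityTheory Matrix InnerProductSpace ComplexConjugate ContinuousMap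
open Filter Set Function TopologicalSpace MeasureTheory

attribute [summit_statement] _root_.MatrixMultiplication

/-- item stmt-MatrixMultiplication-5156 · crux (kind.auto-crux: conjecture-grade) · rank 0 · open · by planner
why it might fail: middle shells m ≈ 2N/3 are sums of C(N,m) ≈ 3^N/2^m translates of xyz^{⊠m}⊠Δ^{⊠(N−m)} and no absorption beyond radius mod 3 is known; X = ARC for the generic Hesse cubic, strictly stronger than R~(cw_2) = 3.
sources: ConnerGesmundoLandsbergVentura2022, arXiv:2411.15789, Landsberg2017, Delsarte1973
[target] X as in § Thesis: border-rank uniformity 3^((1+ε)N) over all Hamming shells H_m^(N), m ≤ N,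
of the Z_3^N addition table. -/
@[route_item "route-MatrixMultiplication-HesseHammingShells", crux]
def ShellUniformity : Prop :=
  ∀ ε : ℝ, 0 < ε → ∃ C : ℝ, ∀ N m : ℕ, m ≤ N → (Literature.Computability.AlgebraicComplexity.algBorderRank (fun x y z : Fin N → Fin 3 => if (∀ i, x i + y i + z i = 0) ∧ (Finset.univ.filter (fun i => x i ≠ y i)).card = m then (1 : ℂ) else 0) : ℝ) ≤ C * (3 : ℝ) ^ ((1 + ε) * N)

/-- item stmt-MatrixMultiplication-17613 · crux · rank 2 · open · by planner
why it might fail: It is Strassen's asymptotic-rank conjecture for one concise free-support 3×3×3 tensor of border rank 4: if the generic pencil value θ_H exceeds 3 and −1 is not exceptional, a universal spectral point F with F(T_{-1}) > 3 exists and refutes it without touching ω.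
sources: Landsberg2017, BurgisserClausenShokrollahi1997, ChristandlVranaZuiddam2023, arXiv:2411.15789, AlmanLi2026
[crux] piece 1 of the BC2-redirect split ShellUniformity ⇐ SignedTableARC ∧ SignedTableGeneric ∧
PencilDominatesShells (crux-strategist 2026-08-17; assembly shellUniformity_of_subs PROVED,
Cruxes/ShellUniformity/Lines/signed_table_split.lean). ARC at ONE NAMED smooth member of the Hesse
pencil: the SIGNED Z_3 addition table T_{-1}(x,y,z) = [x+y+z=0]·(−1)^{[x≠y]} = Δ − P = 2Δ − T_1
(pencil parameter s = −1, i.e. the cubic x³+y³+z³−6xyz, λ = 2: smooth, j ≠ 0, 1728; not a unit point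
{0,1,ω,ω²} — its slice pencil does not commute, bR = 4 — and not a triangle point
{−1/2,−ω/2,−ω²/2,∞} ≅ cw_2; its A₄-orbit on the s-line is {−1,−2,−ω,−2ω,…}, T_{ωs} ≅ T_s by
quadratic phases and T_{σ(s)} ≅ T_s for σ(s) = (1−s)/(1+2s) by the DFT). Powers: T_{-1}^{⊠N}(x,y,z)
= (−1)^{d_H(x,y)}·[x+y+z=0 in Z_3^N], entries 0,±1. Claim R̃(T_{-1}) ≤ 3 (= 3 by flattening); by
Strassen duality (strassen_duality_asymptoticRank_holds, tree) ⟺ no universal spectral point exceeds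
3 at T_{-1} (all quantum functionals equal 3 there: flat marginals). NOT summit-strength: an upper
bound at the SPECIAL algebraic point −1 transfers to no other member (semicontinuity only lets
special points be cheaper), so it implies neither -/
@[route_item "route-MatrixMultiplication-HesseHammingShells"]
def SignedTableARC : Prop :=
  Literature.Computability.AlgebraicComplexity.asymptoticRank (fun x y z : Fin 3 => if x + y + z = 0 then (if x = y then (1 : ℂ) else (-1 : ℂ)) else 0) ≤ 3

/-- item stmt-MatrixMultiplication-5157 · crux · rank 2 · open · by planner
why it might fail: one universal spectral point > 3 at one smooth cubic refutes it and ARC in format (3,3,3); all quantum functionals equal 3 on the line (semistable points), so it needs a NEW spectral point; and it contains X_B (s = −1/2), open since 1990.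
sources: Landsberg2017, Strassen1991, ChristandlVranaZuiddam2023, arXiv:2411.15789, AlmanLi2026, BurgisserClausenShokrollahi1997
[crux] every member of the Hesse line has asymptotic rank ≤ 3: ∀ s ∈ ℂ, R~(T_(1,s,s)) ≤ 3,
T_(1,s,s)(x,y,z) = [x+y+z=0]·(1 if x=y else s) (Strassen's concise asymptotic-rank conjecture,
Landsberg2017 Conj 3.4.6.4, restricted to the pencil x³+y³+z³+6s·xyz; known at the four unit points
s ∈ {0,1,ω,ω²}, open at every other s including the four triangle points s ∈ {−1/2, −ω/2, −ω²/2, ∞}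
≅ cw_2; card items H1/negative twin). Necessary for X (support TargetImpliesHesseARC); at s = −1/2
it is X_B. [difficulty: open-problem] -/
@[route_item "route-MatrixMultiplication-HesseHammingShells"]
def HesseLineARC : Prop :=
  ∀ s : ℂ, Literature.Computability.AlgebraicComplexity.asymptoticRank (fun x y z : Fin 3 => if x + y + z = 0 then (if x = y then (1 : ℂ) else s) else 0) ≤ 3

/-- item stmt-MatrixMultiplication-17614 · crux · rank 3 · open · by planner
why it might fail: −1 may be exceptional: CHNVZ allows finitely many algebraic parameters below the generic value θ_H, and nothing known separates the generic-orbit point −1 (finite stabiliser) from them; a spectral point with F(T_{-1}) < F(T_s) for one s refutes it.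
sources: arXiv:2411.15789, ChristandlVranaZuiddam2023, Nurmiev2000, BremnerHuOeding2014, AlmanLi2026
[crux] piece 2 of the BC2-redirect split of ShellUniformity (crux-strategist 2026-08-17). GENERICITY
OF THE SIGNED TABLE: ∀ s, R̃(T_s) ≤ R̃(T_{-1}) — the parameter −1 is not one of the finitely many
exceptional points of the Hesse pencil T_s(x,y,z) = [x+y+z=0]·(1 if x=y else s). By CHNVZ 2025 Thm
1.2 (PROVED in tree: chnvz_zariskiClosed_asymptoticRank_le_holds) s ↦ R̃(T_s) is Zariski
upper-semicontinuous on ℂ: it takes a generic value θ_H ≥ R̃(xyz) = R̃(cw_2) and is smaller only on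
a finite set E ⊇ {0,1,ω,ω²} (if θ_H > 3); E is Gal(Q̄/Q)- and A₄-stable, every transcendental s is
generic (Aut(ℂ)-invariance), and the claim is −1 ∉ E: 'asymptotic rank drops only at members with
extra stabiliser'. It fixes no value — NOT summit-strength (compares two unknown quantities;
consistent with ω > 2) and NOT ≡ ShellUniformity (implied by it, given R̃ ≥ 3; the converse needs
SignedTableARC). The pencil analogue, at a named algebraic point, of the route's TriangleIsGeneric
(genericity of the triangle point ∞) and of HessianPlane.RegularConstancy (constancy off the 21-line
arrangement — the whole Hesse line b = c lies ON that arrangement, so neither implies the other).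
Finite-degree support a ref -/
@[route_item "route-MatrixMultiplication-HesseHammingShells"]
def SignedTableGeneric : Prop :=
  ∀ s : ℂ, Literature.Computability.AlgebraicComplexity.asymptoticRank (fun x y z : Fin 3 => if x + y + z = 0 then (if x = y then (1 : ℂ) else s) else 0) ≤ Literature.Computability.AlgebraicComplexity.asymptoticRank (fun x y z : Fin 3 => if x + y + z = 0 then (if x = y then (1 : ℂ) else (-1 : ℂ)) else 0)

/-- item stmt-MatrixMultiplication-5158 · crux · rank 3 · open · by planner
why it might fail: xyz has a 2-dimensional torus stabiliser, smooth Hesse members only a finite one (order 648·scalars); if symmetry buys asymptotic savings (as in AlmanLi2026's cw_2-specific speed-ups) the generic member is strictly dearer, θ_H > R~(cw_2), and middle shells bulge.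
sources: arXiv:2411.15789, AlmanLi2026, ConnerGesmundoLandsbergVentura2022, Nurmiev2000, BremnerHuOeding2014
[crux] the triangle xyz (≅ cw_2) is a generic point of the Hesse line for asymptotic rank: ∀ s,
R~(T_(1,s,s)) ≤ R~(xyz). By arXiv:2411.15789 Thm 1.2, R~ takes a generic value θ_H on the line and
is smaller only at finitely many s; the crux says cw_2 is not exceptional, i.e. θ_H = R~(cw_2);
equivalently (interpolation over N+1 generic parameters + Zariski semicontinuity of bR) the border
shell rate lim_N max_m bR(H_m^(N))^{1/N} equals R~(cw_2): "no middle-shell bulge". Necessary for X,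
and X ⟺ TriangleIsGeneric ∧ X_B modulo that semicontinuity glue (card item H2 recast; new
statement). [difficulty: XL] -/
@[route_item "route-MatrixMultiplication-HesseHammingShells"]
def TriangleIsGeneric : Prop :=
  ∀ s : ℂ, Literature.Computability.AlgebraicComplexity.asymptoticRank (fun x y z : Fin 3 => if x + y + z = 0 then (if x = y then (1 : ℂ) else s) else 0) ≤ Literature.Computability.AlgebraicComplexity.asymptoticRank (Literature.Computability.AlgebraicComplexity.xyzTensor ℂ)

/-- item stmt-MatrixMultiplication-0588 · crux · rank 4 · open · by planner
why it might fail: open since CoppersmithWinograd1990 (Blaser2013 Problem 9.8); known 3 ≤ R~(T_cw,2) < 3.931 (AlmanLi2026 Thm 1.3), Kronecker square bR-multiplicative (= 16, ConnerHuangLandsberg2020 Thm 1.1); ω > 2 or a spectral point > 3 at T_cw,2 kills it.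
sources: Blaser2013, AlmanLi2026, ConnerHuangLandsberg2020, ConnerGesmundoLandsbergVentura2022, BurgisserClausenShokrollahi1997
X_B: asymptotic rank of the small Coppersmith–Winograd tensor T_cw,2 (on Fin 3, e_0 distinguished)
is 3: for every ε>0, R(T_cw,2^{⊗N}) = O(3^{(1+ε)N}); Kronecker power written inline over Fin N → Fin
3 (Blaser2013 §9.2 Problem 9.8; arXiv:1909.04785 §1.2). -/
@[route_item "route-MatrixMultiplication-HesseHammingShells"]
def CwTwoAsymptoticRankThree : Prop :=
  ∀ ε : ℝ, 0 < ε → (fun N : ℕ => (Literature.Computability.AlgebraicComplexity.tensorRank (K := ℂ) (fun a b c : Fin N → Fin 3 => ∏ i, (if (a i = 0 ∧ b i = c i ∧ b i ≠ 0) ∨ (b i = 0 ∧ a i = c i ∧ a i ≠ 0) ∨ (c i = 0 ∧ a i = b i ∧ a i ≠ 0) then (1 : ℂ) else 0)) : ℝ)) =O[Filter.atTop] fun N : ℕ => (3 : ℝ) ^ ((1 + ε) * N)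

/-- item stmt-MatrixMultiplication-17615 · support · rank 9 · open · by planner
[support] piece 3 of the BC2-redirect split of ShellUniformity (crux-strategist 2026-08-17) —
THEOREM-GRADE interpolation/genericity glue: one pencil member s⋆ border-dominates every Hamming
shell at every degree, bR(H_m^(N)) ≤ (N+1)·bR(T_{s⋆}^{⊠N}) for all m ≤ N. Proof sketch (all
ingredients in tree/Mathlib except subadditivity of algBorderRank under +, ~100 lines): (1) Alder's
theorem (alder_secantVariety_eq_setOf_algBorderRank_le_holds, AlderStrassenProofs.lean) makes {t :
bR(t) ≤ r} the zero set of polynomials; s ↦ T_s^{⊠N} has entries in ℤ[s], so E_{N,r} := {s :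
bR(T_s^{⊠N}) ≤ r} is finite or all of ℂ; (2) g_N := max_s bR(T_s^{⊠N}) exists (bR ≤ 27^N) and
E_{N,g_N−1} ≠ ℂ is finite, so ⋃_N E_{N,g_N−1} is countable and ℂ uncountable (Cardinal.mk_complex /
not_countable) gives s⋆ with bR(T_{s⋆}^{⊠N}) = g_N for every N; (3) HessePowerExpansion (item 5161,
proved by refuters) T_s^{⊠N} = Σ_{m≤N} s^m H_m^(N) at N+1 distinct nodes and the Vandermonde inverse
(Matrix.vandermonde, det ≠ 0) express H_m^(N) = Σ_j c_{mj} T_{s_j}^{⊠N}; (4) bR(Σ_j c_j t_j) ≤ Σ_j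
bR(t_j) (concatenate approximate decompositions after equalising orders with
IsApproxDecomposition.succ; scalars by algBorderRank_s -/
@[route_item "route-MatrixMultiplication-HesseHammingShells"]
def PencilDominatesShells : Prop :=
  ∃ s : ℂ, ∀ N m : ℕ, m ≤ N → Literature.Computability.AlgebraicComplexity.algBorderRank (fun x y z : Fin N → Fin 3 => if (∀ i, x i + y i + z i = 0) ∧ (Finset.univ.filter (fun i => x i ≠ y i)).card = m then (1 : ℂ) else 0) ≤ (N + 1) * Literature.Computability.AlgebraicComplexity.algBorderRank (Literature.Computability.AlgebraicComplexity.kroneckerPow (fun x y z : Fin 3 => if x + y + z = 0 then (if x = y then (1 : ℂ) else s) else 0) N)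

/-- item stmt-MatrixMultiplication-5159 · support · rank 9 · open · by planner
sources: ConnerGesmundoLandsbergVentura2022
[support] the top shell is the N-th Kronecker power of the tree's xyz tensor on the nose: [∀i,
x_i+y_i+z_i=0] ∧ #{i : x_i ≠ y_i} = N iff (x_i,y_i,z_i) is a permutation of (0,1,2) for every i
(per-coordinate decidable fact, then Finset.prod). [difficulty: provable-now] -/
@[route_item "route-MatrixMultiplication-HesseHammingShells", crux]
def TopShellIsXyzPower : Prop :=
  ∀ (N : ℕ) (x y z : Fin N → Fin 3), (if (∀ i, x i + y i + z i = 0) ∧ (Finset.univ.filter (fun i => x i ≠ y i)).card = N then (1 : ℂ) else 0) = Literature.Computability.AlgebraicComplexity.kroneckerPow (Literature.Computability.AlgebraicComplexity.xyzTensor ℂ) N x y z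

/-- item stmt-MatrixMultiplication-5160 · support · rank 9 · open · by planner
sources: ConnerGesmundoLandsbergVentura2022
[support] xyz ≥ T_cw,2 over ℂ (the inverse of the tree's tensorRestrictsTo_cwTensor_xyzTensor:
cwToXyz is invertible, rows (1,0,0),(0,1,i),(0,1/2,−i/2)); with TensorRestrictsTo.kroneckerPow and
tensorRank_le it turns top-shell bounds into bounds for R(T_cw,2^{⊠N}). [difficulty: provable-now] -/
@[route_item "route-MatrixMultiplication-HesseHammingShells", crux]
def XyzRestrictsToCw : Prop :=
  Literature.Computability.AlgebraicComplexity.TensorRestrictsTo (Literature.Computability.AlgebraicComplexity.xyzTensor ℂ) (Literature.Computability.AlgebraicComplexity.cwTensor ℂ 2)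

/-- item stmt-MatrixMultiplication-5161 · support · rank 9 · open · by planner
sources: Delsarte1973, ConnerGesmundoLandsbergVentura2022
[support] generating identity: the N-th Kronecker power of the Hesse member T_(1,s,s) expands over
the shells, T_(1,s,s)^{⊠N}(x,y,z) = Σ_{m ≤ N} s^m H_m^(N)(x,y,z) (entrywise: ∏_i
[x_i+y_i+z_i=0]·s^{[x_i≠y_i]} = [x+y+z=0]·s^{d_H(x,y)}). [difficulty: provable-now] -/
@[route_item "route-MatrixMultiplication-HesseHammingShells"]
def HessePowerExpansion : Prop :=
  ∀ (s : ℂ) (N : ℕ) (x y z : Fin N → Fin 3), Literature.Computability.AlgebraicComplexity.kroneckerPow (fun a b c : Fin 3 => if a + b + c = 0 then (if a = b then (1 : ℂ) else s) else 0) N x y z = ∑ m ∈ Finset.range (N + 1), s ^ m * (if (∀ i, x i + y i + z i = 0) ∧ (Finset.univ.filter (fun i => x i ≠ y i)).card = m then (1 : ℂ) else 0)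

/-- item stmt-MatrixMultiplication-5162 · support · rank 9 · open · by planner
sources: Delsarte1973, BurgisserClausenShokrollahi1997
[support] FREE THEOREM (new): the shells grouped by radius mod 3, G_r^(N) := Σ_{m ≡ r (3)} H_m^(N),
have RANK ≤ 3^(N+1): G_r = (1/3)Σ_{j=0,1,2} ω^{−rj} T_(1,ω^j,ω^j)^{⊠N} by HessePowerExpansion, and
each T_(1,ω^j,ω^j)^{⊠N} has rank 3^N (UnitPointPowers); then tensorRank_sum_le. Documents that
resolving the radius beyond mod 3 is the whole difficulty. [difficulty: M] -/
@[route_item "route-MatrixMultiplication-HesseHammingShells"]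
def ClassRankBound : Prop :=
  ∀ N r : ℕ, Literature.Computability.AlgebraicComplexity.tensorRank (fun x y z : Fin N → Fin 3 => if (∀ i, x i + y i + z i = 0) ∧ (Finset.univ.filter (fun i => x i ≠ y i)).card % 3 = r then (1 : ℂ) else 0) ≤ 3 ^ (N + 1)

/-- item stmt-MatrixMultiplication-5163 · support · rank 9 · open · by planner
sources: BurgisserClausenShokrollahi1997, Nurmiev2000
[support] at the four unit points s ∈ {0} ∪ μ_3 the Hesse member is a unit tensor in disguise and
its powers have rank ≤ 3^N: T_(1,0,0) = ⟨3⟩; T_(1,1,1) = the Z_3 addition table ≅ ℂ[Z_3] ≅ ⟨3⟩;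
T_(1,ω,ω) = ω^{2x²+2y²+2z²}·T_(1,1,1) and T_(1,ω²,ω²) = ω^{x²+y²+z²}·T_(1,1,1) (diagonal rescalings;
identities checked numerically 2026-08-15); Kronecker powers of restrictions of ⟨3⟩ restrict from
⟨3^N⟩ (TensorRestrictsTo.kroneckerPow, GroupAlgebraTensor lemmas). [difficulty: M] -/
@[route_item "route-MatrixMultiplication-HesseHammingShells"]
def UnitPointPowers : Prop :=
  ∀ s : ℂ, (s ^ 3 = 1 ∨ s = 0) → ∀ N : ℕ, Literature.Computability.AlgebraicComplexity.tensorRank (Literature.Computability.AlgebraicComplexity.kroneckerPow (fun x y z : Fin 3 => if x + y + z = 0 then (if x = y then (1 : ℂ) else s) else 0) N) ≤ 3 ^ N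

/-- item stmt-MatrixMultiplication-5164 · support · rank 9 · open · by planner
sources: BurgisserClausenShokrollahi1997, ChristandlVranaZuiddam2023
[support] glue X → HesseLineARC: by HessePowerExpansion and subadditivity of algBorderRank under
sums and scalars, bR(T_(1,s,s)^{⊠N}) ≤ (N+1)·max_m bR(H_m^(N)) ≤ (N+1)·C·3^((1+ε)N); then R~(t)^N =
R~(t^{⊠N}) ≤ bR(t^{⊠N}) (asymptoticRank_le_algBorderRank, advxxz2025_asymptoticRank_tendsto,
tensorRank_reindex) and ε → 0. [difficulty: M] -/
@[route_item "route-MatrixMultiplication-HesseHammingShells"]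
def TargetImpliesHesseARC : Prop :=
  ShellUniformity → HesseLineARC

/-- item stmt-MatrixMultiplication-5165 · support · rank 9 · open · by planner
sources: ConnerGesmundoLandsbergVentura2022, BurgisserClausenShokrollahi1997, AlmanLi2026
[support] glue HesseLineARC ↔ (TriangleIsGeneric ∧ X_B): (→) 3 ≤ R~(xyz) from the
flattening/gauge-point lower bound (xyz concise), and at s = −1/2 the member is the triangle:
x³+y³+z³−3xyz = (x+y+z)(x+ωy+ω²z)(x+ω²y+ωz), so T_(1,−1/2,−1/2) = gᵀ·(xyz/6) with g the 3×3 matrix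
of these lines (checked numerically), hence R~(T_(1,−1/2,−1/2)) = R~(xyz) = R~(T_cw,2)
(XyzRestrictsToCw + tree's converse) and inf ≤ 3 gives the growth form (Fekete bookkeeping as in
CoppersmithWinograd1990Proofs); (←) chain the two inequalities after converting X_B's growth form to
R~(xyz) ≤ 3. [difficulty: M] -/
@[route_item "route-MatrixMultiplication-HesseHammingShells"]
def HesseFactorisation : Prop :=
  HesseLineARC ↔ (TriangleIsGeneric ∧ CwTwoAsymptoticRankThree)

/-- item stmt-MatrixMultiplication-5166 · assembly · rank 1 · open · by planner
sources: CoppersmithWinograd1990, ConnerGesmundoLandsbergVentura2022, BurgisserClausenShokrollahi1997, Blaser2013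
[assembly] ShellUniformity → ω(ℂ) = 2 (top shell = T_cw,2-power, de-bordering, Coppersmith–Winograd
1990 easy construction in asymptotic-rank form, 2 ≤ ω). -/
@[route_item "route-MatrixMultiplication-HesseHammingShells"]
def Assembly : Prop :=
  ShellUniformity → MatrixMultiplication

/-! D-0027 §2.1 — DECIDING THEOREM (planner-authored via `route open/edit --closes-file`; by planner-rbadge-MatrixMultiplication-HesseHammi-47e82bc4-g2-0 2026-08-15T16:27:56Z):
its hypotheses are this route's items and its conclusion the sub-problem Statement (glue_lint), and it elaborates with this file. -/

/-- DECIDING THEOREM (D-0027 §2.1). The top shell `m = N` of `ShellUniformity` is (`TopShellIsXyzPower`)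
a border-rank bound `bR(xyz^{⊠N}) ≤ C·3^((1+ε)N)`; de-bordering a fixed power (BCS Lemma 15.27,
`isBigO_tensorRank_kroneckerPow_of_algBorderRank_le`), regrouping `xyz^{⊠(N₁q)}` as a restriction of
`(xyz^{⊠N₁})^{⊠q}` (`tensorRank_precomp_le`), padding (`tensorRank_kroneckerPow_add_le`) and
`XyzRestrictsToCw` give the growth form X_B = `CwTwoAsymptoticRankThree`; the PROVED Coppersmith–Winograd
1990 asymptotic-rank form (`matrixMultiplication_of_cw_two … (omega_two_le ℂ)`) then gives `ω(ℂ) = 2`.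
No unproved named fact is used. -/
@[closes "route-MatrixMultiplication-HesseHammingShells"] theorem closes (hX : ShellUniformity) (hTop : TopShellIsXyzPower) (hRes : XyzRestrictsToCw) :
    MatrixMultiplication := by
  suffices hB : CwTwoAsymptoticRankThree from
    Literature.Computability.AlgebraicComplexity.matrixMultiplication_of_cw_two
      Literature.Computability.AlgebraicComplexity.CoppersmithWinograd1990_asymptoticRank_form_holds
      (Literature.Computability.AlgebraicComplexity.omega_two_le ℂ) hB
  intro ε hε
  -- generic core: `X ≥ W` and `bR(X^{⊠N}) ≤ C·3^((1+ε₁)N)` (ε₁ small) give `R(W^{⊠N}) = O(3^((1+ε)N))`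
  suffices core : ∀ (X W : Fin 3 → Fin 3 → Fin 3 → ℂ) (C ε₁ : ℝ), 0 < C → 0 < ε₁ → ε₁ ≤ 1 / 4 →
      ε₁ ≤ ε / 4 → Literature.Computability.AlgebraicComplexity.TensorRestrictsTo X W →
      (∀ N : ℕ, (Literature.Computability.AlgebraicComplexity.algBorderRank
        (Literature.Computability.AlgebraicComplexity.kroneckerPow X N) : ℝ) ≤
          C * (3 : ℝ) ^ ((1 + ε₁) * N)) →
      (fun N : ℕ => (Literature.Computability.AlgebraicComplexity.tensorRank
        (Literature.Computability.AlgebraicComplexity.kroneckerPow W N) : ℝ)) =O[Filter.atTop]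
        fun N : ℕ => (3 : ℝ) ^ ((1 + ε) * N) by
    obtain ⟨ε₁, h0, h1, h2⟩ : ∃ ε₁ : ℝ, 0 < ε₁ ∧ ε₁ ≤ 1 / 4 ∧ ε₁ ≤ ε / 4 :=
      ⟨min ε 1 / 4, by have := lt_min hε one_pos; positivity,
        by linarith [min_le_right ε 1], by linarith [min_le_left ε 1]⟩
    obtain ⟨C, hC⟩ := hX ε₁ h0
    refine core (Literature.Computability.AlgebraicComplexity.xyzTensor ℂ)
      (Literature.Computability.AlgebraicComplexity.cwTensor ℂ 2) (max C 1) ε₁ (by positivity) h0 h1 h2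
      hRes fun N => ?_
    have e : (fun x y z : Fin N → Fin 3 => if (∀ i, x i + y i + z i = 0) ∧
        (Finset.univ.filter (fun i => x i ≠ y i)).card = N then (1 : ℂ) else 0) =
        Literature.Computability.AlgebraicComplexity.kroneckerPow
          (Literature.Computability.AlgebraicComplexity.xyzTensor ℂ) N := by
      funext x y z
      exact hTop N x y z
    rw [← e]
    exact (hC N N le_rfl).trans (mul_le_mul_of_nonneg_right (le_max_left _ _) (by positivity))
  intro X W C ε₁ hC0 hε₁pos hε₁le1 hε₁leε hXW hC
  have hprod : (1 + 2 * ε₁) * (1 + ε₁) ≤ 1 + ε := by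
    nlinarith [mul_le_mul_of_nonneg_left hε₁le1 hε₁pos.le]
  -- (A) regrouping `t^{⊠(n q)}` as a coordinate restriction of `(t^{⊠n})^{⊠q}`
  have hpre : ∀ (t : Fin 3 → Fin 3 → Fin 3 → ℂ) (n q : ℕ),
      Literature.Computability.AlgebraicComplexity.tensorRank
          (Literature.Computability.AlgebraicComplexity.kroneckerPow t (n * q)) ≤
        Literature.Computability.AlgebraicComplexity.tensorRank
          (Literature.Computability.AlgebraicComplexity.kroneckerPow
            (Literature.Computability.AlgebraicComplexity.kroneckerPow t n) q) := by
    intro t n q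
    refine Eq.trans_le ?_ (Literature.Computability.AlgebraicComplexity.tensorRank_precomp_le
      (Literature.Computability.AlgebraicComplexity.kroneckerPow
        (Literature.Computability.AlgebraicComplexity.kroneckerPow t n) q)
      (fun (a : Fin (n * q) → Fin 3) j i => a (finProdFinEquiv (i, j)))
      (fun (a : Fin (n * q) → Fin 3) j i => a (finProdFinEquiv (i, j)))
      (fun (a : Fin (n * q) → Fin 3) j i => a (finProdFinEquiv (i, j))))
    congr 1
    funext a b c
    simp only [Literature.Computability.AlgebraicComplexity.kroneckerPow_apply]
    rw [← Equiv.prod_comp finProdFinEquiv (fun l => t (a l) (b l) (c l)), Fintype.prod_prod_type_right]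
  -- (B) a fixed power `N₁ ≥ 1` with `C ≤ 3^(ε₁ N₁)`
  have h3ε : (1 : ℝ) < (3 : ℝ) ^ ε₁ := Real.one_lt_rpow (by norm_num) hε₁pos
  obtain ⟨N₀, hN₀⟩ := pow_unbounded_of_one_lt C h3ε
  set N₁ : ℕ := N₀ + 1 with hN₁
  have hN₁pos : 0 < N₁ := Nat.succ_pos N₀
  have hN₁one : (1 : ℝ) ≤ N₁ := by exact_mod_cast hN₁pos
  have hCle : C ≤ (3 : ℝ) ^ (ε₁ * N₁) := by
    calc C ≤ ((3 : ℝ) ^ ε₁) ^ N₀ := hN₀.le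
      _ ≤ ((3 : ℝ) ^ ε₁) ^ N₁ := pow_le_pow_right₀ h3ε.le (Nat.le_succ N₀)
      _ = (3 : ℝ) ^ (ε₁ * N₁) := by
          rw [← Real.rpow_natCast, ← Real.rpow_mul (by norm_num : (0 : ℝ) ≤ 3)]
  -- (C) an integer border-rank bound `2 ≤ r ≤ 3^((1+2ε₁) N₁)` for `X^{⊠N₁}`
  obtain ⟨r, hr_ge, hr2, hr_le⟩ : ∃ r : ℕ,
      Literature.Computability.AlgebraicComplexity.algBorderRank
        (Literature.Computability.AlgebraicComplexity.kroneckerPow X N₁) ≤ r ∧ 2 ≤ r ∧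
        (r : ℝ) ≤ (3 : ℝ) ^ ((1 + 2 * ε₁) * N₁) := by
    have hA0 : 0 ≤ C * (3 : ℝ) ^ ((1 + ε₁) * N₁) := by positivity
    have h33 : (3 : ℝ) ≤ (3 : ℝ) ^ ((1 + 2 * ε₁) * N₁) := by
      calc (3 : ℝ) = (3 : ℝ) ^ (1 : ℝ) := (Real.rpow_one 3).symm
        _ ≤ (3 : ℝ) ^ ((1 + 2 * ε₁) * N₁) := by
            refine Real.rpow_le_rpow_of_exponent_le (by norm_num) ?_
            nlinarith
    refine ⟨max ⌊C * (3 : ℝ) ^ ((1 + ε₁) * N₁)⌋₊ 2, (Nat.le_floor (hC N₁)).trans (le_max_left _ _),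
      le_max_right _ _, ?_⟩
    rw [Nat.cast_max]
    refine max_le ?_ ?_
    · calc (⌊C * (3 : ℝ) ^ ((1 + ε₁) * N₁)⌋₊ : ℝ) ≤ C * (3 : ℝ) ^ ((1 + ε₁) * N₁) := Nat.floor_le hA0
        _ ≤ (3 : ℝ) ^ (ε₁ * N₁) * (3 : ℝ) ^ ((1 + ε₁) * N₁) :=
            mul_le_mul_of_nonneg_right hCle (by positivity)
        _ = (3 : ℝ) ^ ((1 + 2 * ε₁) * N₁) := by
            rw [← Real.rpow_add (by norm_num : (0 : ℝ) < 3)]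
            congr 1
            ring
    · have : ((2 : ℕ) : ℝ) = 2 := by norm_num
      rw [this]
      linarith
  -- (D) de-border the fixed power (BCS Lemma 15.27, proved in tree)
  obtain ⟨c, hc0, hcw⟩ :=
    (Literature.Computability.AlgebraicComplexity.isBigO_tensorRank_kroneckerPow_of_algBorderRank_le
      hr_ge hr2 hε₁pos).exists_pos
  obtain ⟨q₀, hq₀⟩ := Filter.eventually_atTop.1 hcw.bound
  -- padding constant for the remainder powers
  obtain ⟨M, hM1, hMT⟩ : ∃ M : ℕ, 1 ≤ M ∧ Literature.Computability.AlgebraicComplexity.tensorRank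
      (Literature.Computability.AlgebraicComplexity.kroneckerPow X 1) ≤ M :=
    ⟨max 1 (Literature.Computability.AlgebraicComplexity.tensorRank
      (Literature.Computability.AlgebraicComplexity.kroneckerPow X 1)), le_max_left _ _, le_max_right _ _⟩
  -- (E) the pointwise bound for all large `N`
  refine Asymptotics.IsBigO.of_bound (c * (M : ℝ) ^ N₁) ?_
  filter_upwards [Filter.eventually_ge_atTop (N₁ * q₀)] with N hN
  rw [Real.norm_of_nonneg (Nat.cast_nonneg _), Real.norm_of_nonneg (by positivity)]
  have hNqs : N₁ * (N / N₁) + N % N₁ = N := Nat.div_add_mod N N₁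
  have hq₀q : q₀ ≤ N / N₁ := (Nat.le_div_iff_mul_le hN₁pos).2 ((Nat.mul_comm q₀ N₁).le.trans hN)
  -- ℕ-level: restriction, splitting, regrouping, padding
  have h2 : Literature.Computability.AlgebraicComplexity.tensorRank
        (Literature.Computability.AlgebraicComplexity.kroneckerPow W N) ≤
      Literature.Computability.AlgebraicComplexity.tensorRank
        (Literature.Computability.AlgebraicComplexity.kroneckerPow
          (Literature.Computability.AlgebraicComplexity.kroneckerPow X N₁) (N / N₁)) * M ^ N₁ := by
    have h := Literature.Computability.AlgebraicComplexity.tensorRank_kroneckerPow_add_le X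
      (N₁ * (N / N₁)) (N % N₁)
    rw [hNqs] at h
    refine (hXW.kroneckerPow N).tensorRank_le.trans (h.trans (Nat.mul_le_mul (hpre X N₁ (N / N₁)) ?_))
    have h' := Literature.Computability.AlgebraicComplexity.tensorRank_kroneckerPow_mul_le_pow X 1 (N % N₁)
    rw [one_mul] at h'
    exact h'.trans ((Nat.pow_le_pow_left hMT _).trans
      (Nat.pow_le_pow_right hM1 (Nat.mod_lt N hN₁pos).le))
  -- ℝ-level
  have h3 := hq₀ (N / N₁) hq₀q
  rw [Real.norm_of_nonneg (Nat.cast_nonneg _), Real.norm_of_nonneg (by positivity)] at h3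
  have h4 : (r : ℝ) ^ ((1 + ε₁) * (N / N₁ : ℕ)) ≤ (3 : ℝ) ^ ((1 + ε) * N) := by
    have hqN : (N₁ : ℝ) * (N / N₁ : ℕ) ≤ N := by exact_mod_cast Nat.mul_div_le N N₁
    calc (r : ℝ) ^ ((1 + ε₁) * (N / N₁ : ℕ))
        ≤ ((3 : ℝ) ^ ((1 + 2 * ε₁) * N₁)) ^ ((1 + ε₁) * (N / N₁ : ℕ)) :=
          Real.rpow_le_rpow (Nat.cast_nonneg _) hr_le (by positivity)
      _ = (3 : ℝ) ^ ((1 + 2 * ε₁) * N₁ * ((1 + ε₁) * (N / N₁ : ℕ))) := by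
          rw [← Real.rpow_mul (by norm_num : (0 : ℝ) ≤ 3)]
      _ ≤ (3 : ℝ) ^ ((1 + ε) * N) := by
          refine Real.rpow_le_rpow_of_exponent_le (by norm_num) ?_
          calc (1 + 2 * ε₁) * N₁ * ((1 + ε₁) * (N / N₁ : ℕ))
              = ((1 + 2 * ε₁) * (1 + ε₁)) * ((N₁ : ℝ) * (N / N₁ : ℕ)) := by ring
            _ ≤ (1 + ε) * N := mul_le_mul hprod hqN (by positivity) (by positivity)
  calc (Literature.Computability.AlgebraicComplexity.tensorRank
        (Literature.Computability.AlgebraicComplexity.kroneckerPow W N) : ℝ)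
      ≤ (Literature.Computability.AlgebraicComplexity.tensorRank
          (Literature.Computability.AlgebraicComplexity.kroneckerPow
            (Literature.Computability.AlgebraicComplexity.kroneckerPow X N₁) (N / N₁)) : ℝ) *
          (M : ℝ) ^ N₁ := by exact_mod_cast h2
    _ ≤ (c * (r : ℝ) ^ ((1 + ε₁) * (N / N₁ : ℕ))) * (M : ℝ) ^ N₁ :=
        mul_le_mul_of_nonneg_right h3 (by positivity)
    _ ≤ (c * (3 : ℝ) ^ ((1 + ε) * N)) * (M : ℝ) ^ N₁ :=
        mul_le_mul_of_nonneg_right (mul_le_mul_of_nonneg_left h4 hc0.le) (by positivity)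
    _ = (c * (M : ℝ) ^ N₁) * (3 : ℝ) ^ ((1 + ε) * N) := by ring

end Summit.MatrixMultiplication.MatrixMultiplication.Theses.HesseHammingShells
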